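import Literature.MathematicalPhysics.QuantumFieldTheory.Balaban1983to89.DagDischargedII
import Literature.MathematicalPhysics.QuantumFieldTheory.Balaban1983to89.B14Eq02Iterate

/-!
# `Balaban1983to89.B14NodeKnit` — YM-DAG node N11 · [Balaban1988Convergent] CMP **119** (1988) 243–285, Theorem 1 p. 262
# (with the Theorem of p. 245 and the ASSUMED operation 𝐑 of p. 244): the node statement `Dag.B14_main (DagBinding.leavesP w P)`
# KNIT BY NAME from the binding's 𝐑-leaf, the (0.2) trajectory and the record's pins, MODULO EXACTLY TWO DISPLAYED PRINTED SLOTS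

statement-level bookkeeping over published theorems with citation tags; kernel-checked compositions of tree theorems;
nothing here is a claim about the Yang–Mills mass gap.

CITATION HEADER (lean-in-tree rule).  Source: T. Bałaban, *Convergent renormalization expansions for lattice gauge theories*,
Commun. Math. Phys. **119**, 243–285 (1988), doi:10.1007/bf01217741 [Balaban1988Convergent] (cell paper B14 = «[III]» of
[Balaban1989LargeFieldI]∕[Balaban1989LargeFieldII]).  Seat `pub-ymgap-dag-n11-a` (YM-PLAN Track A, HUMAN RULING D-0062: the
KNIT-BY-NAME seat of node N11; chair rulings R420 ∕ R422 ∕ R424 ∕ R429; director-ym LINE №12).  Companion modules, all BY NAME and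
UNCHANGED: `…Dag` (`B14_main` :224), `…DagBinding` (`leavesP` :1412, `PrintedCarriers14R` :1109, `ROpLeaf` :1128),
`…DagDischargedII` (`Upstream.ofPrintedAllXPN`, `ofPrintedAllXPN_leaves`), `…B14` (`ThmP245PrintedI`, `ThmP245SpacesI`,
`RAssumedP244`, `inductiveAssumptions_of_thmP245I`, `thmP245PrintedI_of_spacesI`), `…B14.Eq02Iterate` ((0.2) WITH BODY:
`rho`, `densityRGI`), `…B14.Sect1Repr` (`rho0` = the Wilson start), `…Step` (`DensityRGI`; LFTower currency `LFStepObligation`,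
`B14Thm1Shape_of_obligation`), `…B16` (`InductionBase`, `InductionStep`), `…Node00.WorldFrame` (`b14_main_iff`).

THE NODE (Dag.lean :224, verbatim docstring there): «N11 · B14 Thm 1 p. 262 (with the Theorem p. 245: the §2 description is
reproduced by T): cites [I], [II] = B12, B13 (small-field analysis), [16] = B10 (template), [15] = B11, [14] = B8, [12] = B7,
[13] = B9; R is only ASSUMED (p. 244); the flow control (2.6)–(2.9) of §2 enters as an input».
```
def B14_main (ℓ : Leaves) : Prop :=
  ℓ.b7 → ℓ.b8 → ℓ.b9 → ℓ.b10 → ℓ.b11 → (ℓ.smallCouplings → ℓ.smallFieldInductive) →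
    (ℓ.smallCouplings → ℓ.flowControl) → (ℓ.rOperation → (ℓ.smallCouplings → ℓ.densitiesDescribed))
```
At the leaves binding of record `ℓ := DagBinding.leavesP w P` the node's OWN leaf is `densitiesDescribed ↦ ∀ k ≤ P.K,
(w.C P).Sect2Form k` — a FIELD of the construction `w.C : B16.Construction` (`B16.RunData.Sect2Form`, «ρ_k has the form (2.18)
[III] and satisfies all the conditions and bounds described in Sect. 2 [III]», left abstract there), and the 𝐑-leaf is
`rOperation ↦ (w.up P).rOperation`, which every binding of record sets to `DagBinding.ROpLeaf V = B14.RAssumedP244 V.R V.Scorr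
V.S V.K` ([Balaban1988Convergent] p. 244, verbatim: *«The operation 𝐑 serves this purpose. We will not describe it here, we will
only assume that it has some properties incorporated in the inductive description of the effective actions.»*;
`DagDischargedII.ofPrintedAllXPN_leaves`).  THE PRINTED PROOF STRUCTURE OF THEOREM 1 (p. 262 [PDF 20], verbatim): *«… the sequence
of densities {ρ_k}, generated by successive applications of the operations 𝐑T to the density ρ₀ = exp[−(1∕g₀²)A − E], satisfies
all the inductive assumptions»* = the START `ρ₀` + the THEOREM OF p. 245 (*«If ρ_k satisfies the assumptions described in detail
in Sect. 2, then Tρ_k satisfies also the corresponding assumptions.»* — *«This whole paper gives a proof of this»*) at every step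
+ the ASSUMED 𝐑, along (0.2) `ρ_k = 𝐑Tρ_{k−1} = (𝐑T)^kρ₀` — kernel-checked by the B14 sub-cell as
`B14.inductiveAssumptions_of_thmP245I` over the cell's density carriers.

WHAT THIS FILE PROVES (0 `sorry`, 0 `def`, standard axioms; every ingredient BY NAME).
§1 `rAssumed_of_rOpLeaf`: the bound 𝐑-leaf `ROpLeaf V` IS the hypothesis `B14.RAssumedP244 D.R V.Scorr V.S K` that the
   induction consumes, for every (0.2) trajectory `D : Step.DensityRGI V.P V.G av` whose large-field operations are the carrier's
   (`D.R = V.R`) and every `K ≤ V.K`; `rOpLeaf_of_up_eq` reads the leaf off the N-binding `Upstream.ofPrintedAllXPN X Y Z V W`.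
§2 **`b14_main_of_thmP245I`** — THE KNIT: at any binding world `w` and run `P`, `Dag.B14_main (leavesP w P)` follows from
   (P1) the binding's 𝐑-leaf names the carrier: `(leavesP w P).rOperation → ROpLeaf V`;
   (P2) a (0.2) trajectory `D` on `V`'s lattices with `D.R = V.R` and `P.K ≤ V.K`;
   (P3) the record's reading of its own leaf: `V.S k (D.ρ k) → (w.C P).Sect2Form k` for `k ≤ P.K` («ρ_k lies in the index-k space of
        the §2 description» ⇒ «ρ_k has the §2 form»; at NODE 00's Stage-5 record this is the DEFINITION of `Sect2Form`);
   and EXACTLY TWO DISPLAYED PRINTED SLOTS, each handed the node's in-edges it may consume: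
   (S0) the START, Thm 1 p. 262: under the interval hypothesis, `V.S 0 (D.ρ 0)` («ρ₀ = exp[−(1∕g₀²)A − E]» lies in the index-0 space);
   (S1) THE THEOREM OF p. 245 in its sequence reading over the inhabited carrier, `B14.ThmP245PrintedI D.T D.ρ V.S V.Scorr P.K`,
        GIVEN the leaves `b7 b8 b9 b10 b11` ([12] = B7, [14] = B8, [13] = B9, [16] = B10, [15] = B11), the interval hypothesis,
        the small-field inductive assumptions ([I], [II]) and the flow control (2.6) — i.e. Sects. 1–3 of the paper, its whole
        analytic content, AT THE OBJECTS `(V, D)`.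
   The 𝐑-leaf is LOAD-BEARING (consumed through §1, not discarded); nothing of Sects. 1–3 is asserted.
   Corollaries: `…_of_thmP245SpacesI` (slot (S1) in the SPACE reading of the second remark of p. 262); `…_iterate` (the trajectory
   IS (0.2) WITH BODY, `B14.Eq02Iterate.densityRGI T V.R ρ₀`, so (P2) is `rfl`); `…_wilsonStart` (moreover `ρ₀ := B14.Sect1Repr.rho0
   P.g0 E`, the printed start at the run's bare coupling); `…_ofPrintedAllXPN` ((P1) discharged by `rfl` at the N-binding of record,
   `DagDischargedII.ofPrintedAllXPN_leaves`); `atRecord_b14_main_of_thmP245I` (the `S_N11 Rec` shape of the chair's cut R420 (C):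
   `∀ w, Rec w → ∀ P, Dag.B14_main (leavesP w P)` for ANY record predicate `Rec` supplying (P1)–(P3), (S0), (S1) per run — R422: typed
   over a record PARAMETER, never closed over the un-pinned Stage-2∕3 frame).
§3 `b14_main_of_lfStepObligation` — the same node in the LFTower currency of `…Step` (the typing the NODE 00 scoping report names for
   `Sect2Form`: representation (2.18) ∧ `Step.LFHyp T c k` ∧ `Step.LFHypImproved T c β k`), through `Step.B14Thm1Shape_of_obligation`
   BY NAME: pins `T.flow = (w.C P).flow`, the RG equations (0.20) along the run (`(leavesP w P).rgFlow`, the object slot W00 of the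
   cut), the reading `Repr k ∧ LFHyp T c k ∧ LFHypImproved T c β k → Sect2Form k`; slots: the represented start `Repr 0`, the sign
   conditions `Step.LFSigns`, and the PER-STEP OBLIGATION `Step.LFStepObligation (B14.H033Interval w.γ) Repr T c β P.K` given the
   in-edges AND the 𝐑-leaf (in this currency the step is the composite 𝐑T of p. 262: *«the operation 𝐑T transforms the space with
   the index k into the space with the index k+1»*, so the 𝐑-leaf is handed to the slot as an antecedent, not consumed here).
§4 `b14_main_of_inductionStep` — the node at EVERY run of a world from `B16.InductionBase w.C w.γ` ∧ `B16.InductionStep w.C w.γ`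
   ([Balaban1989LargeFieldII] p. 390–391's sentence typed by the B16 sub-cell; the coarsest reading: it discards the 𝐑-leaf and
   the in-edges — recorded only to display how the B16 module's `thm1_of_steps` shape sits over the node).

SLOT CENSUS FOR N11 (what a DISCHARGE at NODE 00's Stage-5 record needs beyond this file; numbers, not adjectives): (P1)–(P3) are
FIELD EQUATIONS of the record (definitional at Stage 5; today no `B16.Construction` of record exists — `Node00.WorldFrame`
§4, FIRST3-READINESS §2 N11 «C-bound»); (S0) is the k = 0 clause (in the LFTower currency `Step.LFHyp.zero` ∕ `LFHypImproved.zero`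
make the TERM part vacuous; the representation (2.18) of `ρ₀` with `𝐓₀ = 1` remains); (S1) is Sects. 1–3 of [Balaban1988Convergent]
at the record — 41 journal pages, typed in the tree at display level only (`B14Sect3` scalar chains (3.7)∕(3.8)∕(3.14)∕(3.19), (3.36)
sign erratum, (3.40), (3.53), (3.61), (3.62); `B14Thm2Assembly.thm2Printed_of_pointData`; `B14Def3p279Step`; `B14Seam245`;
located negatives AS TYPED on sub-displays `B14Sect3.ineq368_printed_fails` :349, `logdet_scalar_336_printed_sign_fails` :717,
`fwdDiff_lam353_printed_fails` :899, `B14LogDet336Matrix.eq336_printed_fails_smul_one` :212, `B14FlowStep.printed_hyps_fail_26d_27a`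
:1615 — none of which touches the node statement, all being about displayed intermediate formulas) — the -b seat's hunting ground.
VACUITY NOTE (kernel fact `Node00.WorldFrame.b14_main_of_trivial_sect2Form`): a record whose `V.S` ∕ `Sect2Form` are trivially true
satisfies every hypothesis here with no content; the referee's clause-by-clause reading of the Stage-5 DEFINITIONS of `V.S`, `V.Scorr`,
`Sect2Form` against (2.1)–(2.42) pp. 254–262 is what makes an instance of §2 a discharge (YM-PLAN §2a INTERIM DISCHARGE CURRENCY).

HONEST FRAMING.  A count-neutral SLOT landing (R429 (4)(i): «a theorem modulo ANY named printed Prop is a slot landing»): the node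
N11 is NOT discharged here; Theorem 1's analytic content (the Theorem of p. 245) is a displayed hypothesis, the 𝐑 operation is the
printed ASSUMPTION of p. 244 (constructed only in [Balaban1989LargeFieldI]∕[Balaban1989LargeFieldII] = nodes N12∕N13), (2.6)'s
derivation from the β-functions is the located step T11.F (`Dag.FlowStepPrinted`).  One finite four-torus programme at fixed ε,
Bałaban AS PRINTED with locators; nothing continuum ∕ ℝ⁴ ∕ OS ∕ mass gap ∕ Clay.
-/

namespace Literature.MathematicalPhysics.QuantumFieldTheory.Balaban1983to89.B14NodeKnit

open DagBinding

/-! ## §1. The bound 𝐑-leaf is the induction's 𝐑-hypothesis -/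

section RLeaf

variable (V : PrintedCarriers14R) {av : ∀ j, Averaging V.P j V.G}

/-- **The 𝐑-leaf, consumed.**  For a (0.2) trajectory `D` on the carrier's lattices whose large-field operations ARE the
carrier's (`D.R k ρ = V.R k ρ`) and a number of steps `K ≤ V.K`, the bound leaf `ROpLeaf V` ([Balaban1988Convergent] p. 244:
*«we will only assume that it has some properties incorporated in the inductive description of the effective actions»*, typed
`∀ k < V.K, ∀ ρ′, Scorr (k+1) ρ′ → S (k+1) (R k ρ′)`) gives the hypothesis `B14.RAssumedP244 D.R V.Scorr V.S K` of the induction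
(0.2).  Pure logic. [cite: Balaban1988Convergent, p.244] -/
theorem rAssumed_of_rOpLeaf (D : Step.DensityRGI V.P V.G av) {K : ℕ} (hK : K ≤ V.K)
    (hR : ∀ k ρ, D.R k ρ = V.R k ρ) (h : ROpLeaf V) : B14.RAssumedP244 D.R V.Scorr V.S K := by
  intro k hk ρ' hρ'
  rw [hR]
  exact h k (lt_of_lt_of_le hk hK) ρ' hρ'

/-- At the N-binding of record `w.up P = Upstream.ofPrintedAllXPN X Y Z V W` the world's 𝐑-leaf IS `ROpLeaf V`
(`DagDischargedII.ofPrintedAllXPN_leaves`, `rfl` there), hence implies it. [cite: Balaban1988Convergent, p.244] -/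
theorem rOpLeaf_of_up_eq (w : WorldP) (P : B12.RunParams) (X : PrintedCarriersR) (Y : PrintedCarriers9X)
    (Z : PrintedCarriers11) (W : PrintedCarriers15) (hup : w.up P = Upstream.ofPrintedAllXPN X Y Z V W)
    (h : (leavesP w P).rOperation) : ROpLeaf V := by
  have e := (DagDischargedII.ofPrintedAllXPN_leaves X Y Z V W).2.2.2.2.2.2.2.2.2.2.1
  change (w.up P).rOperation at h
  rw [hup, e] at h
  exact h

end RLeaf

/-! ## §2. THE KNIT: N11 from the 𝐑-leaf, a (0.2) trajectory and the record's pins, modulo the start and the Theorem of p. 245 -/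

section Knit

variable (w : WorldP) (P : B12.RunParams) (V : PrintedCarriers14R) {av : ∀ j, Averaging V.P j V.G}

/-- **N11 · `Dag.B14_main (leavesP w P)` KNIT BY NAME** ([Balaban1988Convergent] Thm 1 p. 262 with the Theorem of p. 245 and the
assumed 𝐑 of p. 244, at the node's statement of record).  Pins: (P1) `hV` the world's 𝐑-leaf names the carrier `V`; (P2) `D` a
(0.2) trajectory on `V`'s lattices with `hR : D.R = V.R`, `hK : P.K ≤ V.K`; (P3) `hS` membership of `ρ_k` in the index-`k` space of the
§2 description gives the construction's `Sect2Form k`.  Slots (displayed, printed, NOT proved here): (S0) `h0` the start `ρ₀` lies in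
the index-0 space (Thm 1 p. 262: *«ρ₀ = exp[−(1∕g₀²)A − E]»*), under the interval hypothesis; (S1) `hT` THE THEOREM OF p. 245
(*«If ρ_k satisfies the assumptions described in detail in Sect. 2, then Tρ_k satisfies also the corresponding assumptions.»*) in the
sequence reading `B14.ThmP245PrintedI D.T D.ρ V.S V.Scorr P.K`, GIVEN the node's in-edges `b7 … b11`, the interval hypothesis, the
small-field inductive assumptions and the flow control (2.6).  Proof = `B14.inductiveAssumptions_of_thmP245I` with the 𝐑-hypothesis
supplied by the LEAF (`rAssumed_of_rOpLeaf`) — the leaf is consumed, not discarded.  Count-neutral slot landing; nothing of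
Sects. 1–3 asserted. [cite: Balaban1988Convergent, Thm 1 p.262; Theorem p.245; p.244] -/
theorem b14_main_of_thmP245I (hV : (leavesP w P).rOperation → ROpLeaf V) (D : Step.DensityRGI V.P V.G av)
    (hK : P.K ≤ V.K) (hR : ∀ k ρ, D.R k ρ = V.R k ρ)
    (hS : ∀ k, k ≤ P.K → V.S k (D.ρ k) → (w.C P).Sect2Form k)
    (h0 : (leavesP w P).smallCouplings → V.S 0 (D.ρ 0))
    (hT : (leavesP w P).b7 → (leavesP w P).b8 → (leavesP w P).b9 → (leavesP w P).b10 → (leavesP w P).b11 →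
      (leavesP w P).smallCouplings → (leavesP w P).smallFieldInductive → (leavesP w P).flowControl →
        B14.ThmP245PrintedI D.T D.ρ V.S V.Scorr P.K) :
    Dag.B14_main (leavesP w P) := by
  intro h7 h8 h9 h10 h11 hsf hfc hrop hsc k hk
  exact hS k hk (B14.inductiveAssumptions_of_thmP245I D (h0 hsc) (hT h7 h8 h9 h10 h11 hsc (hsf hsc) (hfc hsc))
    (rAssumed_of_rOpLeaf V D hK hR (hV hrop)) k hk)

/-- The same with slot (S1) in the SPACE reading of the Theorem of p. 245 (second remark of p. 262, verbatim: *«For a given index k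
we introduce the space of all densities satisfying the conditions of the inductive assumption. The theorem states that the operation
𝐑T transforms the space with the index k into the space with the index k+1.»*, restricted to T): `B14.ThmP245SpacesI D.T V.S V.Scorr
P.K` implies the sequence reading (`B14.thmP245PrintedI_of_spacesI`). [cite: Balaban1988Convergent, Theorem p.245 with remark p.262] -/
theorem b14_main_of_thmP245SpacesI (hV : (leavesP w P).rOperation → ROpLeaf V) (D : Step.DensityRGI V.P V.G av)
    (hK : P.K ≤ V.K) (hR : ∀ k ρ, D.R k ρ = V.R k ρ)
    (hS : ∀ k, k ≤ P.K → V.S k (D.ρ k) → (w.C P).Sect2Form k)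
    (h0 : (leavesP w P).smallCouplings → V.S 0 (D.ρ 0))
    (hT : (leavesP w P).b7 → (leavesP w P).b8 → (leavesP w P).b9 → (leavesP w P).b10 → (leavesP w P).b11 →
      (leavesP w P).smallCouplings → (leavesP w P).smallFieldInductive → (leavesP w P).flowControl →
        B14.ThmP245SpacesI D.T V.S V.Scorr P.K) :
    Dag.B14_main (leavesP w P) :=
  b14_main_of_thmP245I w P V hV D hK hR hS h0 fun h7 h8 h9 h10 h11 hsc hsf hfc =>
    B14.thmP245PrintedI_of_spacesI (hT h7 h8 h9 h10 h11 hsc hsf hfc) D.ρ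

/-- **The trajectory IS (0.2) WITH BODY.**  With `D := B14.Eq02Iterate.densityRGI T V.R ρ₀` — the sequence `ρ_k = 𝐑Tρ_{k−1} =
(𝐑T)^kρ₀` ([Balaban1988Convergent] (0.2) p. 244) generated by renormalization transformations `T k` (0.1) and THE CARRIER'S
operations `V.R` from a start `ρ₀` — pin (P2) is `rfl` and the densities are `B14.Eq02Iterate.rho T V.R ρ₀ k`.
[cite: Balaban1988Convergent, (0.2) p.244; Thm 1 p.262] -/
theorem b14_main_of_thmP245I_iterate (hV : (leavesP w P).rOperation → ROpLeaf V)
    (T : ∀ k, RTOpI V.P k V.G (av k)) (ρ₀ : Density V.P 0 V.G) (hK : P.K ≤ V.K)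
    (hS : ∀ k, k ≤ P.K → V.S k (B14.Eq02Iterate.rho T V.R ρ₀ k) → (w.C P).Sect2Form k)
    (h0 : (leavesP w P).smallCouplings → V.S 0 ρ₀)
    (hT : (leavesP w P).b7 → (leavesP w P).b8 → (leavesP w P).b9 → (leavesP w P).b10 → (leavesP w P).b11 →
      (leavesP w P).smallCouplings → (leavesP w P).smallFieldInductive → (leavesP w P).flowControl →
        B14.ThmP245PrintedI T (B14.Eq02Iterate.rho T V.R ρ₀) V.S V.Scorr P.K) :
    Dag.B14_main (leavesP w P) :=
  b14_main_of_thmP245I w P V hV (B14.Eq02Iterate.densityRGI T V.R ρ₀) hK (fun _ _ => rfl) hS h0 hT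

/-- **… from the printed Wilson start.**  Moreover `ρ₀ := B14.Sect1Repr.rho0 P.g0 E = exp[−(1∕g₀²)A − E]` at the run's bare coupling
`g₀ = P.g0` ([Balaban1988Convergent] p. 243 and Thm 1 p. 262; `A` = `Setup.wilsonAction4`, `E` the normalization constant).
[cite: Balaban1988Convergent, (0.2) p.244; Thm 1 p.262] -/
theorem b14_main_of_thmP245I_wilsonStart (hV : (leavesP w P).rOperation → ROpLeaf V)
    (T : ∀ k, RTOpI V.P k V.G (av k)) (E : ℝ) (hK : P.K ≤ V.K)
    (hS : ∀ k, k ≤ P.K → V.S k (B14.Eq02Iterate.rho T V.R (B14.Sect1Repr.rho0 P.g0 E) k) → (w.C P).Sect2Form k)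
    (h0 : (leavesP w P).smallCouplings → V.S 0 (B14.Sect1Repr.rho0 P.g0 E))
    (hT : (leavesP w P).b7 → (leavesP w P).b8 → (leavesP w P).b9 → (leavesP w P).b10 → (leavesP w P).b11 →
      (leavesP w P).smallCouplings → (leavesP w P).smallFieldInductive → (leavesP w P).flowControl →
        B14.ThmP245PrintedI T (B14.Eq02Iterate.rho T V.R (B14.Sect1Repr.rho0 P.g0 E)) V.S V.Scorr P.K) :
    Dag.B14_main (leavesP w P) :=
  b14_main_of_thmP245I_iterate w P V hV T (B14.Sect1Repr.rho0 P.g0 E) hK hS h0 hT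

/-- **At the N-binding of record** `w.up P = Upstream.ofPrintedAllXPN X Y Z V W` (NODE 00's bindings, Stages 1–3, have this shape at
every run) pin (P1) is discharged by `rfl` (`rOpLeaf_of_up_eq`); the in-edge leaves of slot (S1) then read `b7 = B7.Concl …`,
`b8 = B8LeafR …`, `b9 = B9LeafX Y`, `b10 = B10.Thm1Printed … ∧ B10.Thm2Printed …`, `b11 = B11Leaf Z` (`ofPrintedAllXPN_leaves`).
[cite: Balaban1988Convergent, Thm 1 p.262; Theorem p.245; p.244] -/
theorem b14_main_ofPrintedAllXPN_of_thmP245I (X : PrintedCarriersR) (Y : PrintedCarriers9X) (Z : PrintedCarriers11)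
    (W : PrintedCarriers15) (hup : w.up P = Upstream.ofPrintedAllXPN X Y Z V W) (D : Step.DensityRGI V.P V.G av)
    (hK : P.K ≤ V.K) (hR : ∀ k ρ, D.R k ρ = V.R k ρ)
    (hS : ∀ k, k ≤ P.K → V.S k (D.ρ k) → (w.C P).Sect2Form k)
    (h0 : (leavesP w P).smallCouplings → V.S 0 (D.ρ 0))
    (hT : (leavesP w P).b7 → (leavesP w P).b8 → (leavesP w P).b9 → (leavesP w P).b10 → (leavesP w P).b11 →
      (leavesP w P).smallCouplings → (leavesP w P).smallFieldInductive → (leavesP w P).flowControl →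
        B14.ThmP245PrintedI D.T D.ρ V.S V.Scorr P.K) :
    Dag.B14_main (leavesP w P) :=
  b14_main_of_thmP245I w P V (rOpLeaf_of_up_eq V w P X Y Z W hup) D hK hR hS h0 hT

end Knit

/-! ### The `S_N11 Rec` shape of the chair's cut R420 (C) (UVSplit): ANY record predicate supplying the pins and the two slots per run -/

section AtRecord

/-- **`S_N11`-shaped** (R420 (C) ∕ R422: «every stub is typed over the PINNED carriers of record, or with an explicit `Rec`
parameter»): for ANY predicate `Rec` on binding worlds such that every `Rec`-world carries, at every run, a carrier `V`, averaging
operations and a (0.2) trajectory `D` with the pins (P1)–(P3) and the slots (S0)–(S1) of `b14_main_of_thmP245I`, the node N11 holds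
AT EVERY RUN OF EVERY `Rec`-WORLD: `∀ w, Rec w → ∀ P, Dag.B14_main (leavesP w P)`.  The day NODE 00's Stage-5 record predicate is a
tree constant, instantiation is a substitution (its datum∕family arguments are not read by `B14_main`).
[cite: Balaban1988Convergent, Thm 1 p.262; Theorem p.245; p.244] -/
theorem atRecord_b14_main_of_thmP245I (Rec : WorldP → Prop)
    (h : ∀ w, Rec w → ∀ P : B12.RunParams, ∃ (V : PrintedCarriers14R) (av : ∀ j, Averaging V.P j V.G)
      (D : Step.DensityRGI V.P V.G av),
        ((leavesP w P).rOperation → ROpLeaf V) ∧ P.K ≤ V.K ∧ (∀ k ρ, D.R k ρ = V.R k ρ) ∧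
        (∀ k, k ≤ P.K → V.S k (D.ρ k) → (w.C P).Sect2Form k) ∧
        ((leavesP w P).smallCouplings → V.S 0 (D.ρ 0)) ∧
        ((leavesP w P).b7 → (leavesP w P).b8 → (leavesP w P).b9 → (leavesP w P).b10 → (leavesP w P).b11 →
          (leavesP w P).smallCouplings → (leavesP w P).smallFieldInductive → (leavesP w P).flowControl →
            B14.ThmP245PrintedI D.T D.ρ V.S V.Scorr P.K)) :
    ∀ w, Rec w → ∀ P : B12.RunParams, Dag.B14_main (leavesP w P) := by
  intro w hw P
  obtain ⟨V, av, D, hV, hK, hR, hS, h0, hT⟩ := h w hw P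
  exact b14_main_of_thmP245I w P V hV D hK hR hS h0 hT

end AtRecord

/-! ## §3. The LFTower currency of `…Step`: N11 through `Step.B14Thm1Shape_of_obligation` -/

section TowerCurrency

variable (w : WorldP) (P : B12.RunParams)
variable {G : Type*} [GaugeGroup G] {Φ 𝒢 𝔄 : Type*} {Pₛ : Params}

/-- **N11 in the LFTower currency** ([Balaban1988Convergent] §2 pp. 258–262 as typed by `Step.LFHyp` ∕ `LFHypImproved` over an
abstract tower `T : Step.LFTower Pₛ G Φ 𝒢 𝔄` of terms `𝐄^{(j)}, 𝐑^{(j)}, 𝐁^{(j)}`; the representation (2.18) of `ρ_k` itself is the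
reader-level predicate `Repr k`).  Pins: `hflow` the tower's flow is the construction's; `hrg` the RG equations (0.20) hold along
the run (`(leavesP w P).rgFlow` — the cut's object slot W00; Thm 1 p. 262: *«{g_k}, determined by the recursive renormalization
group (Callan-Symanzik) equations (0.18), (0.20) [I]»*); `hS` the reading `Repr k ∧ LFHyp T c k ∧ LFHypImproved T c βc k →
Sect2Form k`.  Slots: `h0` the represented start; `hsg` the sign conditions `Step.LFSigns` (print: β = 1∕4, κ, E₀, B₀ ≥ 0,
g_k > 0); `hstep` THE PER-STEP OBLIGATION `Step.LFStepObligation (B14.H033Interval w.γ) Repr T c βc P.K` (p. 262: *«the operation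
𝐑T transforms the space with the index k into the space with the index k+1»*), GIVEN the in-edges and the 𝐑-leaf — in this
currency the step is the composite 𝐑T, so the leaf is an antecedent of the slot.  Proof = `Step.B14Thm1Shape_of_obligation` BY
NAME.  Count-neutral slot landing. [cite: Balaban1988Convergent, Thm 1 and remarks p.262; (2.23)–(2.42) pp.258–261] -/
theorem b14_main_of_lfStepObligation (T : Step.LFTower Pₛ G Φ 𝒢 𝔄) (c : Step.LFConsts) (βc : ℝ) (Repr : ℕ → Prop)
    (hflow : T.flow = (w.C P).flow) (hrg : (leavesP w P).rgFlow)
    (hS : ∀ k, k ≤ P.K → Repr k → Step.LFHyp T c k → Step.LFHypImproved T c βc k → (w.C P).Sect2Form k)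
    (h0 : (leavesP w P).smallCouplings → Repr 0) (hsg : (leavesP w P).smallCouplings → Step.LFSigns T c βc P.K)
    (hstep : (leavesP w P).b7 → (leavesP w P).b8 → (leavesP w P).b9 → (leavesP w P).b10 → (leavesP w P).b11 →
      (leavesP w P).smallCouplings → (leavesP w P).smallFieldInductive → (leavesP w P).flowControl →
        (leavesP w P).rOperation → Step.LFStepObligation (B14.H033Interval w.γ) Repr T c βc P.K) :
    Dag.B14_main (leavesP w P) := by
  intro h7 h8 h9 h10 h11 hsf hfc hrop hsc k hk
  have hshape := Step.B14Thm1Shape_of_obligation (B14.H033Interval w.γ) Repr T c βc P.K (h0 hsc) (hsg hsc)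
    (hstep h7 h8 h9 h10 h11 hsc (hsf hsc) (hfc hsc) hrop)
  have hrgT : T.flow.SatisfiesRG P.K := by rw [hflow]; exact hrg
  have h033 : B14.H033Interval w.γ T.flow P.K := by rw [hflow]; exact hsc
  obtain ⟨hr, h1, h2⟩ := hshape hrgT h033 k hk
  exact hS k hk hr h1 h2

end TowerCurrency

/-! ## §4. The coarsest reading: N11 at every run from `B16.InductionBase` ∧ `B16.InductionStep` -/

section B16Currency

variable (w : WorldP)

/-- If the construction `w.C` satisfies the BASE and the STEP of the induction on `k` at the world's threshold `w.γ` as typed by the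
B16 sub-cell (`B16.InductionBase` = Thm 1 p. 262's start; `B16.InductionStep` = [Balaban1989LargeFieldII] pp. 390–391, verbatim there:
*«the result 𝐑ρ_k of the 𝐑-operation can be written in the form (2.18) [III], with all the expressions satisfying the induction
hypothesis described in Sect. 2 [III]»*), then N11 holds at every run — the proof shape `B16.thm1_of_steps`, read at the node.  The
𝐑-leaf and the in-edges are DISCARDED in this reading (the step sentence already contains [IV] and Sects. 1–3 of [III]); recorded only
to place the B16 module's typing over the node.  Pure logic. [cite: Balaban1989LargeFieldII, Thm 1 p.355 and pp.390–391; Balaban1988Convergent, Thm 1 p.262] -/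
theorem b14_main_of_inductionStep (hb : B16.InductionBase w.C w.γ) (hs : B16.InductionStep w.C w.γ) (P : B12.RunParams) :
    Dag.B14_main (leavesP w P) := by
  intro _ _ _ _ _ _ _ _ hsc k
  induction k with
  | zero => intro _; exact hb P hsc
  | succ n ih => intro hk; exact hs P hsc n (by omega) (ih (by omega))

end B16Currency

end Literature.MathematicalPhysics.QuantumFieldTheory.Balaban1983to89.B14NodeKnit
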